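import Literature.Geometry.Kaehler.SiegelTorusThetaDivisorEtaModular
import Literature.Analysis.SpecialFunctions.RiemannThetaBlockDiagonal
import HarnessLib

/-!
# `η ≡ 0` on the theta divisor over the whole decomposable locus of `𝒜_g`: for `Z` in the
# `Sp_{2g}(ℤ)`-orbit of `𝔥_{g₁} × 𝔥_{g₂}` the Gauss map of `Θ_Z` ramifies at every smooth point

[tag: lange-cav-complex-tori] [linked: HodgeConjecture (lit-hodgefound SKELETON §A2, row A2-213)]

Layer `Literature/Geometry/Kaehler`, namespaces `Literature.Geometry.Kaehler.SCV` / `.ComplexTorus`; lane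
`lit-hodgefound` (Track 2 foundations library), skeleton seat `lit-hodgefound-skel-2` (generation 43), plan
row A2-213 — de Jong's Prop. 2.3 in the SIEGEL model (A2-201 `ComplexTorusBoxDivisorBorderedHessianVanishes`
proved it in the abstract model `F ⊠ G` on `WithLp 2 (V₁ × V₂)`): here `Z = Ω₁ ⊕ Ω₂` block diagonal,
`ϑ(z, Ω₁ ⊕ Ω₂) = ϑ(z₁, Ω₁) ϑ(z₂, Ω₂)` (tree `RiemannThetaBlockDiagonal`), transported to the whole
`Sp_{2g}(ℤ)`-orbit — the decomposable locus `𝒜_g^{dec}` — by A2-210 (`SiegelTorusThetaDivisorEtaModular`: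
the vanishing of `η = det B_ϑ` on `ϑ = 0` is a modular invariant). Theorems only; no definition, no named fact.

Sources, VERBATIM. R. de Jong, *Theta functions on the theta divisor*, Rocky Mountain J. Math. 40 (2010)
[held `paper:arxiv-math_0611810`], Prop. 2.3 (chunk p0004): "Assume that `(A,Θ)` is decomposable […] Then
the function `η` is identically zero on `Θ`. Proof. […] we can write `θ = F(z_1,…,z_k) G(z_{k+1},…,z_g)`
[…] `(θ_{ij}) = ( F_{ij}G  F_iG_j ; F_jG_i  FG_{ij} )`, `ᵗ(θ_i) = (F_iG, FG_i)`; on `F = 0` […] the last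
`g − k` columns of `(θ_{ij} θ_i ; θ_j 0)` […] span a space of dimension at most `g − k − 1` [sic: the
columns `(F_iG_j ; 0)` are proportional to `(F_i ; 0)`]"; §1 (chunk p0003): "the Gauss map on `Θ^s` is
generically finite exactly when `(A,Θ)` is indecomposable"; §4 (chunk p0008): the transformation of
`(θ_{ij} θ_i ; θ_j 0)` under `Sp(2g,ℤ)` on `ϑ = 0`. S. Grushevsky, R. Salvati Manni, Proc. AMS 136 (2008),
Definition 5 (the action `M·Z`, `ᵗ(γZ+δ)⁻¹z`, `M[ε;δ]`); S. Grushevsky, Z. Xie (2025), Remark 6.2 (p0034: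
"the theta function is the product `θ(τ, z) = θ′(τ′, z′) · θ(τ″, z″)`"). Ch. Birkenhake, H. Lange, *Complex
Abelian Varieties*, §2.2.3 (p. 94: for the product divisor "all fibres of `G` are of dimension `≥ 1`").

Dictionary. `E, E₁, E₂` complex normed spaces, `P : E →L[ℂ] E₁`, `Q : E →L[ℂ] E₂`; the bordered matrix
`B_f(z)[b]` of A2-200 in a family `b : ι′ → E`; in §2–§3 `E = ℂ^{n₁+n₂}`, `P₁ z = z|_{ℂ^{n₁}}`
(`i ↦ z(castAdd i)`), `P₂ z = z|_{ℂ^{n₂}}` (`i ↦ z(natAdd i)`), `e_k = Pi.single k 1`,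
`Ω = reindex(fromBlocks Ω₁ 0 0 Ω₂)`, `D = denom(M, Ω) = γΩ + δ`.

## Contents

* §1 (SCV, pull-back along a continuous linear map) `fderiv_comp_clm_apply_of_differentiable`,
  `fderiv_fderiv_comp_clm_apply_of_differentiable` (`D^k(f ∘ P)(z) = D^k f(Pz) ∘ P^{⊗k}`, `k = 1, 2`),
  **`bordered_comp_clm`** (`B_{f∘P}(z)[b] = B_f(Pz)[P ∘ b]`), **`det_borderedHessian_comp_clm_eq_zero`**
  (a family vector in `Ker P` gives a zero row), **`det_borderedHessian_mul_comp_clm_eq_zero`** (de Jong's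
  column argument: `det B_{(g∘Q)·(f∘P)}(z)[b] = 0` at `f(Pz) = 0` when some `b_j ∈ Ker P`).
* §2 (Siegel, `Z = Ω₁ ⊕ Ω₂`) `differentiable_riemannTheta_of_posDef_im`, `restrictFst_single_natAdd`,
  `restrictSnd_single_castAdd`, `riemannTheta_blockDiag_eq_mul_comp`,
  **`det_borderedHessian_riemannTheta_blockDiag_eq_zero`** (`n₁, n₂ ≥ 1`: `det B_{ϑ(·,Ω₁⊕Ω₂)}(v)[e] = 0`
  at EVERY zero `v` — `η ≡ 0` on `Θ_{Ω₁ ⊕ Ω₂}`), `det_borderedHessian_riemannTheta_blockDiag_eq_zero_family`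
  (the same in every family `b` of `n₁ + n₂` vectors, A2-210 `det_bordered_baseChange`).
* §3 (the orbit) **`det_borderedHessian_riemannThetaChar_moeb_blockDiag_eq_zero`**: for every
  `M ∈ Sp_{2g}(ℤ)` and every zero `w` of `ϑ[M[0]](·, M(Ω₁ ⊕ Ω₂))`, `det B(w)[e] = 0` — `η` vanishes
  identically on the theta divisor of every p.p.a.v. of the decomposable locus
  `𝒜_g^{dec} ⊇ Sp_{2g}(ℤ)·(𝔥_{n₁} × 𝔥_{n₂})`: its Gauss map ramifies at every smooth point.

## What is NOT here

The converse ("generically finite exactly when indecomposable": `η ≢ 0` for indecomposable `(A,Θ)`), which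
is Prop. 2.2.6's dominance (open pointer (1) of the skeleton list).

## References

* [DeJong2010ThetaFunctionsThetaDivisor] R. de Jong, Theta functions on the theta divisor, Rocky Mountain
  J. Math. 40 (2010), Prop. 2.3, §1, §4.
* [GrushevskySalvatiManni2008] S. Grushevsky, R. Salvati Manni, Proc. AMS 136 (2008), Definition 5.
* [GrushevskyXie2025] S. Grushevsky, Z. Xie (2025), Remark 6.2.
* [LangeBirkenhake1992] Ch. Birkenhake, H. Lange, *Complex Abelian Varieties* (1992), §2.2.3 (p. 94).
-/

noncomputable section

open scoped Matrix Topology Real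
open Set Function Module Complex Matrix
open Literature.Analysis.SpecialFunctions Literature.Analysis.Complex

namespace Literature.Geometry.Kaehler

namespace SCV

/-! ### §1 Pull-back of the bordered Hessian along a continuous linear map -/

section PullBack

variable {E E₁ E₂ : Type*} [NormedAddCommGroup E] [NormedSpace ℂ E] [NormedAddCommGroup E₁]
  [NormedSpace ℂ E₁] [NormedAddCommGroup E₂] [NormedSpace ℂ E₂] {ι' : Type*} [Fintype ι'] [DecidableEq ι']

/-- `d(f ∘ P)(z)(w) = df(Pz)(Pw)`. [cite: DeJong2010ThetaFunctionsThetaDivisor, Prop. 2.3, proof (chunk p0004: "`ᵗ(θ_i) = (F_iG, FG_i)`")] -/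
theorem fderiv_comp_clm_apply_of_differentiable {f : E₁ → ℂ} (hf : Differentiable ℂ f) (P : E →L[ℂ] E₁)
    (z w : E) : fderiv ℂ (fun u => f (P u)) z w = fderiv ℂ f (P z) (P w) := by
  rw [show (fun u => f (P u)) = f ∘ ⇑P from rfl, fderiv_comp z (hf (P z)) P.differentiableAt, P.fderiv]
  rfl

/-- `D²(f ∘ P)(z)(w, w′) = D²f(Pz)(Pw, Pw′)`. [cite: DeJong2010ThetaFunctionsThetaDivisor, Prop. 2.3, proof (chunk p0004: "`(θ_{ij}) = ( F_{ij}G  F_iG_j ; F_jG_i  FG_{ij} )`")] -/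
theorem fderiv_fderiv_comp_clm_apply_of_differentiable {f : E₁ → ℂ} (hf : Differentiable ℂ f)
    (P : E →L[ℂ] E₁) (z w w' : E) :
    fderiv ℂ (fderiv ℂ (fun u => f (P u))) z w w' = fderiv ℂ (fderiv ℂ f) (P z) (P w) (P w') := by
  have hfun : (fun u => f (P u)) = f ∘ ⇑P := rfl
  have h2 := iteratedFDeriv_two_apply (𝕜 := ℂ) (f ∘ ⇑P) z ![w, w']
  simp only [Matrix.cons_val_zero, Matrix.cons_val_one] at h2
  rw [hfun, ← h2, P.iteratedFDeriv_comp_right (contDiff_of_differentiable hf (n := 2)) z (i := 2)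
      (by norm_num), ContinuousMultilinearMap.compContinuousLinearMap_apply, iteratedFDeriv_two_apply]
  rfl

omit [Fintype ι'] [DecidableEq ι'] in
/-- **`B_{f∘P}(z)[b] = B_f(Pz)[P ∘ b]`**: the bordered Hessian of a pull-back is the bordered Hessian in the
pushed-forward family. [cite: DeJong2010ThetaFunctionsThetaDivisor, Prop. 2.3, proof (chunk p0004)] -/
theorem bordered_comp_clm {f : E₁ → ℂ} (hf : Differentiable ℂ f) (P : E →L[ℂ] E₁) (z : E) (b : ι' → E) :
    Matrix.fromBlocks (Matrix.of fun i j => fderiv ℂ (fderiv ℂ (fun u => f (P u))) z (b i) (b j))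
        (Matrix.of fun i (_ : Unit) => fderiv ℂ (fun u => f (P u)) z (b i))
        (Matrix.of fun (_ : Unit) j => fderiv ℂ (fun u => f (P u)) z (b j)) (0 : Matrix Unit Unit ℂ) =
      Matrix.fromBlocks (Matrix.of fun i j => fderiv ℂ (fderiv ℂ f) (P z) (P (b i)) (P (b j)))
        (Matrix.of fun i (_ : Unit) => fderiv ℂ f (P z) (P (b i)))
        (Matrix.of fun (_ : Unit) j => fderiv ℂ f (P z) (P (b j))) (0 : Matrix Unit Unit ℂ) := by
  simp only [fderiv_fderiv_comp_clm_apply_of_differentiable hf P, fderiv_comp_clm_apply_of_differentiable hf P]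

/-- **A family vector in `Ker P` gives a zero row**: if `P(b_j) = 0` then `det B_{f∘P}(z)[b] = 0` (the
direction `b_j` is in the kernel of both `d(f∘P)(z)` and `D²(f∘P)(z)`).
[cite: DeJong2010ThetaFunctionsThetaDivisor, Prop. 2.3, proof (chunk p0004: "span a space of dimension at most `g − k − 1`")] -/
theorem det_borderedHessian_comp_clm_eq_zero {f : E₁ → ℂ} (hf : Differentiable ℂ f) (P : E →L[ℂ] E₁)
    (z : E) (b : ι' → E) {j : ι'} (hj : P (b j) = 0) :
    (Matrix.fromBlocks (Matrix.of fun i j => fderiv ℂ (fderiv ℂ (fun u => f (P u))) z (b i) (b j))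
        (Matrix.of fun i (_ : Unit) => fderiv ℂ (fun u => f (P u)) z (b i))
        (Matrix.of fun (_ : Unit) j => fderiv ℂ (fun u => f (P u)) z (b j)) (0 : Matrix Unit Unit ℂ)).det =
      0 := by
  rw [bordered_comp_clm hf P z b]
  refine Matrix.det_eq_zero_of_row_eq_zero (Sum.inl j) fun k => ?_
  rcases k with k | ⟨⟩
  · rw [Matrix.fromBlocks_apply₁₁, Matrix.of_apply, hj, map_zero, _root_.zero_apply]
  · rw [Matrix.fromBlocks_apply₁₂, Matrix.of_apply, hj, map_zero]

/-- **De Jong's column argument**: for `θ = (g ∘ Q)·(f ∘ P)` at a point with `f(Pz) = 0`,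
`det B_θ(z)[b] = g(Qz)^{card+1} det B_{f∘P}(z)[b]` (A2-200 `det_borderedHessian_mul`) `= 0` as soon as some
family vector lies in `Ker P`. [cite: DeJong2010ThetaFunctionsThetaDivisor, Prop. 2.3, proof (chunk p0004)] -/
theorem det_borderedHessian_mul_comp_clm_eq_zero {f : E₁ → ℂ} {g : E₂ → ℂ} (hf : Differentiable ℂ f)
    (hg : Differentiable ℂ g) (P : E →L[ℂ] E₁) (Q : E →L[ℂ] E₂) {z : E} (hz : f (P z) = 0) (b : ι' → E)
    {j : ι'} (hj : P (b j) = 0) :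
    (Matrix.fromBlocks
        (Matrix.of fun i j => fderiv ℂ (fderiv ℂ ((fun u => g (Q u)) * fun u => f (P u))) z (b i) (b j))
        (Matrix.of fun i (_ : Unit) => fderiv ℂ ((fun u => g (Q u)) * fun u => f (P u)) z (b i))
        (Matrix.of fun (_ : Unit) j => fderiv ℂ ((fun u => g (Q u)) * fun u => f (P u)) z (b j))
        (0 : Matrix Unit Unit ℂ)).det = 0 := by
  have hfP : Differentiable ℂ fun u => f (P u) := hf.comp P.differentiable
  have hgQ : Differentiable ℂ fun u => g (Q u) := hg.comp Q.differentiable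
  rw [det_borderedHessian_mul hfP hgQ (v := z) hz b, det_borderedHessian_comp_clm_eq_zero hf P z b hj,
    mul_zero]

end PullBack

end SCV

/-! ### §2 The Siegel model: `η ≡ 0` on `Θ_{Ω₁ ⊕ Ω₂}` -/

namespace ComplexTorus

open Literature.NumberTheory.Automorphic (siegelUpperHalfSpace)
open Literature.NumberTheory.ModularForms.SiegelUpperHalfSpace (moeb denom)

section BlockDiag

variable {n₁ n₂ : ℕ} {Ω₁ : Matrix (Fin n₁) (Fin n₁) ℂ} {Ω₂ : Matrix (Fin n₂) (Fin n₂) ℂ}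
  {Ω : Matrix (Fin (n₁ + n₂)) (Fin (n₁ + n₂)) ℂ}
  (hΩ : Ω = Matrix.reindex finSumFinEquiv finSumFinEquiv (Matrix.fromBlocks Ω₁ 0 0 Ω₂))
  (hpos₁ : (Matrix.of fun i j => (Ω₁ i j).im).PosDef) (hpos₂ : (Matrix.of fun i j => (Ω₂ i j).im).PosDef)

/-- `ϑ(·, Z)` is entire for `Im Z ≻ 0`. [cite: LangeBirkenhake1992, §3.3.2 Prop. 3.3.6] -/
theorem differentiable_riemannTheta_of_posDef_im {g : ℕ} {Z : Matrix (Fin g) (Fin g) ℂ}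
    (hpos : (Matrix.of fun i j => (Z i j).im).PosDef) : Differentiable ℂ (riemannTheta Z) := by
  obtain ⟨c, hc, hY⟩ := exists_pos_mul_sum_sq_le_of_posDef_im Z hpos
  exact differentiable_riemannTheta Z hc hY

/-- The restriction `z ↦ z|_{ℂ^{n₁}}` kills the coordinate vectors of the second block.
[cite: DeJong2010ThetaFunctionsThetaDivisor, Prop. 2.3, proof (chunk p0004: "the last `g − k` columns")] -/
theorem restrictFst_single_natAdd (j : Fin n₂) :
    (ContinuousLinearMap.pi fun i : Fin n₁ =>
        ContinuousLinearMap.proj (R := ℂ) (φ := fun _ : Fin (n₁ + n₂) => ℂ) (Fin.castAdd n₂ i))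
      (Pi.single (Fin.natAdd n₁ j) (1 : ℂ)) = 0 := by
  funext i
  rw [ContinuousLinearMap.pi_apply, ContinuousLinearMap.proj_apply, Pi.zero_apply]
  refine Pi.single_eq_of_ne (fun h => ?_) _
  have h1 := congrArg Fin.val h
  simp only [Fin.val_castAdd, Fin.val_natAdd] at h1
  have h2 := i.isLt
  omega

/-- The restriction `z ↦ z|_{ℂ^{n₂}}` kills the coordinate vectors of the first block.
[cite: DeJong2010ThetaFunctionsThetaDivisor, Prop. 2.3, proof (chunk p0004)] -/
theorem restrictSnd_single_castAdd (i : Fin n₁) :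
    (ContinuousLinearMap.pi fun j : Fin n₂ =>
        ContinuousLinearMap.proj (R := ℂ) (φ := fun _ : Fin (n₁ + n₂) => ℂ) (Fin.natAdd n₁ j))
      (Pi.single (Fin.castAdd n₂ i) (1 : ℂ)) = 0 := by
  funext j
  rw [ContinuousLinearMap.pi_apply, ContinuousLinearMap.proj_apply, Pi.zero_apply]
  refine Pi.single_eq_of_ne (fun h => ?_) _
  have h1 := congrArg Fin.val h
  simp only [Fin.val_castAdd, Fin.val_natAdd] at h1
  have h2 := i.isLt
  omega

include hΩ hpos₁ hpos₂ in
/-- **`ϑ(·, Ω₁ ⊕ Ω₂) = (ϑ(·, Ω₂) ∘ P₂) · (ϑ(·, Ω₁) ∘ P₁)`** as functions on `ℂ^{n₁+n₂}` (tree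
`riemannTheta_blockDiag_of_posDef`, in the shape of A2-200's `g · f`). [cite: GrushevskyXie2025, Remark 6.2 (p0034)] [cite: DeJong2010ThetaFunctionsThetaDivisor, Prop. 2.3, proof (chunk p0004: "`θ = F(z_1,…,z_k) G(z_{k+1},…,z_g)`")] -/
theorem riemannTheta_blockDiag_eq_mul_comp :
    riemannTheta Ω =
      (fun z : Fin (n₁ + n₂) → ℂ => riemannTheta Ω₂
          ((ContinuousLinearMap.pi fun j : Fin n₂ =>
            ContinuousLinearMap.proj (R := ℂ) (φ := fun _ : Fin (n₁ + n₂) => ℂ) (Fin.natAdd n₁ j)) z)) *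
        fun z : Fin (n₁ + n₂) → ℂ => riemannTheta Ω₁
          ((ContinuousLinearMap.pi fun i : Fin n₁ =>
            ContinuousLinearMap.proj (R := ℂ) (φ := fun _ : Fin (n₁ + n₂) => ℂ) (Fin.castAdd n₂ i)) z) := by
  funext z
  rw [Pi.mul_apply, riemannTheta_blockDiag_of_posDef hΩ hpos₁ hpos₂ z, mul_comm]
  rfl

include hΩ hpos₁ hpos₂ in
/-- **`η ≡ 0` ON THE THETA DIVISOR OF `Ω₁ ⊕ Ω₂`** (`n₁, n₂ ≥ 1`): at EVERY zero `v` of `ϑ(·, Ω₁ ⊕ Ω₂)`,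
`det ( ϑ_{ij} ϑ_i ; ϑ_j 0 )(v) = 0` in the standard coordinates — the Gauss map of the decomposable theta
divisor `Θ₁ × X₂ ∪ X₁ × Θ₂` ramifies at every smooth point (and at the singular ones `dϑ = 0`).
[cite: DeJong2010ThetaFunctionsThetaDivisor, Prop. 2.3 (chunk p0004: "the function `η` is identically zero on `Θ`")] [cite: LangeBirkenhake1992, §2.2.3 (p. 94: "all fibres of `G` are of dimension `≥ 1`")] -/
theorem det_borderedHessian_riemannTheta_blockDiag_eq_zero [NeZero n₁] [NeZero n₂]
    (v : Fin (n₁ + n₂) → ℂ) (hv : riemannTheta Ω v = 0) :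
    (Matrix.fromBlocks
        (Matrix.of fun i j : Fin (n₁ + n₂) => fderiv ℂ (fderiv ℂ (riemannTheta Ω)) v
          (Pi.single i (1 : ℂ)) (Pi.single j (1 : ℂ)))
        (Matrix.of fun (i : Fin (n₁ + n₂)) (_ : Unit) => fderiv ℂ (riemannTheta Ω) v (Pi.single i (1 : ℂ)))
        (Matrix.of fun (_ : Unit) (j : Fin (n₁ + n₂)) => fderiv ℂ (riemannTheta Ω) v (Pi.single j (1 : ℂ)))
        (0 : Matrix Unit Unit ℂ)).det = 0 := by
  have hd₁ := differentiable_riemannTheta_of_posDef_im hpos₁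
  have hd₂ := differentiable_riemannTheta_of_posDef_im hpos₂
  have hP₁ := restrictFst_single_natAdd (n₁ := n₁) (0 : Fin n₂)
  have hP₂ := restrictSnd_single_castAdd (n₂ := n₂) (0 : Fin n₁)
  rcases (riemannTheta_blockDiag_eq_zero_iff_of_posDef hΩ hpos₁ hpos₂ v).1 hv with h₁ | h₂
  · -- first sheet `ϑ(v₁, Ω₁) = 0`: the row of `e_{n₁ + 0}` vanishes
    rw [riemannTheta_blockDiag_eq_mul_comp hΩ hpos₁ hpos₂]
    exact SCV.det_borderedHessian_mul_comp_clm_eq_zero (f := riemannTheta Ω₁) (g := riemannTheta Ω₂) hd₁ hd₂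
      (ContinuousLinearMap.pi fun i : Fin n₁ =>
        ContinuousLinearMap.proj (R := ℂ) (φ := fun _ : Fin (n₁ + n₂) => ℂ) (Fin.castAdd n₂ i))
      (ContinuousLinearMap.pi fun j : Fin n₂ =>
        ContinuousLinearMap.proj (R := ℂ) (φ := fun _ : Fin (n₁ + n₂) => ℂ) (Fin.natAdd n₁ j))
      (z := v) h₁ (fun k => (Pi.single k (1 : ℂ) : Fin (n₁ + n₂) → ℂ)) hP₁
  · -- second sheet `ϑ(v₂, Ω₂) = 0`: commute the factors, the row of `e_0` vanishes
    rw [riemannTheta_blockDiag_eq_mul_comp hΩ hpos₁ hpos₂, mul_comm]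
    exact SCV.det_borderedHessian_mul_comp_clm_eq_zero (f := riemannTheta Ω₂) (g := riemannTheta Ω₁) hd₂ hd₁
      (ContinuousLinearMap.pi fun j : Fin n₂ =>
        ContinuousLinearMap.proj (R := ℂ) (φ := fun _ : Fin (n₁ + n₂) => ℂ) (Fin.natAdd n₁ j))
      (ContinuousLinearMap.pi fun i : Fin n₁ =>
        ContinuousLinearMap.proj (R := ℂ) (φ := fun _ : Fin (n₁ + n₂) => ℂ) (Fin.castAdd n₂ i))
      (z := v) h₂ (fun k => (Pi.single k (1 : ℂ) : Fin (n₁ + n₂) → ℂ)) hP₂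

include hΩ hpos₁ hpos₂ in
/-- The same in EVERY family `b` of `n₁ + n₂` vectors (`det B[b] = det(P)² det B[e]`, A2-210
`det_bordered_baseChange`, `P_{li} = (b_i)_l`). [cite: DeJong2010ThetaFunctionsThetaDivisor, Prop. 2.3 (chunk p0004)] [cite: GrushevskySalvatiManni2008, Definition 6 and Remark 7 (independence of the coordinates)] -/
theorem det_borderedHessian_riemannTheta_blockDiag_eq_zero_family [NeZero n₁] [NeZero n₂]
    (v : Fin (n₁ + n₂) → ℂ) (hv : riemannTheta Ω v = 0) (b : Fin (n₁ + n₂) → (Fin (n₁ + n₂) → ℂ)) :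
    (Matrix.fromBlocks
        (Matrix.of fun i j : Fin (n₁ + n₂) => fderiv ℂ (fderiv ℂ (riemannTheta Ω)) v (b i) (b j))
        (Matrix.of fun (i : Fin (n₁ + n₂)) (_ : Unit) => fderiv ℂ (riemannTheta Ω) v (b i))
        (Matrix.of fun (_ : Unit) (j : Fin (n₁ + n₂)) => fderiv ℂ (riemannTheta Ω) v (b j))
        (0 : Matrix Unit Unit ℂ)).det = 0 := by
  have hb : b = fun i => ∑ l, (Matrix.of fun l i => b i l) l i • (Pi.single l (1 : ℂ) : Fin (n₁ + n₂) → ℂ) := by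
    funext i
    simp only [Matrix.of_apply]
    conv_lhs => rw [← (Pi.basisFun ℂ (Fin (n₁ + n₂))).sum_repr (b i)]
    simp only [Pi.basisFun_repr, Pi.basisFun_apply]
  rw [hb, SCV.det_bordered_baseChange, det_borderedHessian_riemannTheta_blockDiag_eq_zero hΩ hpos₁ hpos₂ v hv,
    mul_zero]

/-! ### §3 The `Sp_{2g}(ℤ)`-orbit: `η ≡ 0` over the decomposable locus `𝒜_g^{dec}` -/

variable (hΩ₁ : ∀ i j, Ω₁ i j = Ω₁ j i) (hΩ₂ : ∀ i j, Ω₂ i j = Ω₂ j i)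

include hΩ hpos₁ hpos₂ hΩ₁ hΩ₂ in
/-- **`η ≡ 0` ON THE THETA DIVISOR OF EVERY P.P.A.V. OF THE DECOMPOSABLE LOCUS.** For `M ∈ Sp_{2g}(ℤ)`,
`g = n₁ + n₂`, `n₁, n₂ ≥ 1`, and the characteristic `M[0]` carried by `M` from `[0;0]`: at EVERY zero `w` of
`ϑ[M[0]](·, M(Ω₁ ⊕ Ω₂))`, `det ( ϑ_{ij} ϑ_i ; ϑ_j 0 )(w) = 0` — with `v = ᵗD w`, `D = γΩ + δ`, the
point `w = ᵗD⁻¹v` corresponds to the zero `v` of `ϑ(·, Ω₁ ⊕ Ω₂)` (A2-210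
`riemannThetaChar_moeb_mulVec_eq_zero_iff`) where `η = 0` (§2), and the vanishing of `η` on `ϑ = 0` is a
modular invariant (A2-210 `det_borderedHessian_riemannThetaChar_moeb_mulVec_eq_zero_iff`). The Gauss map of
the theta divisor ramifies at every smooth point for every `Z ∈ Sp_{2g}(ℤ)·(𝔥_{n₁} × 𝔥_{n₂})`.
[cite: DeJong2010ThetaFunctionsThetaDivisor, Prop. 2.3 (chunk p0004) and §4, proof of Thm. 1.3 (chunk p0008)] [cite: GrushevskySalvatiManni2008, Definition 5 (p0004 of the held text)] -/
theorem det_borderedHessian_riemannThetaChar_moeb_blockDiag_eq_zero [NeZero n₁] [NeZero n₂]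
    {M : Matrix (Fin (n₁ + n₂) ⊕ Fin (n₁ + n₂)) (Fin (n₁ + n₂) ⊕ Fin (n₁ + n₂)) ℤ}
    (hM : M ∈ Matrix.symplecticGroup (Fin (n₁ + n₂)) ℤ) (w : Fin (n₁ + n₂) → ℂ)
    (hw : riemannThetaChar (thetaCharFst M 0 0) (thetaCharSnd M 0 0) (moeb (M.map ((↑) : ℤ → ℂ)) Ω) w = 0) :
    (Matrix.fromBlocks
        (Matrix.of fun i j : Fin (n₁ + n₂) => fderiv ℂ (fderiv ℂ (riemannThetaChar (thetaCharFst M 0 0)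
          (thetaCharSnd M 0 0) (moeb (M.map ((↑) : ℤ → ℂ)) Ω))) w (Pi.single i (1 : ℂ)) (Pi.single j (1 : ℂ)))
        (Matrix.of fun (i : Fin (n₁ + n₂)) (_ : Unit) => fderiv ℂ (riemannThetaChar (thetaCharFst M 0 0)
          (thetaCharSnd M 0 0) (moeb (M.map ((↑) : ℤ → ℂ)) Ω)) w (Pi.single i (1 : ℂ)))
        (Matrix.of fun (_ : Unit) (j : Fin (n₁ + n₂)) => fderiv ℂ (riemannThetaChar (thetaCharFst M 0 0)
          (thetaCharSnd M 0 0) (moeb (M.map ((↑) : ℤ → ℂ)) Ω)) w (Pi.single j (1 : ℂ)))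
        (0 : Matrix Unit Unit ℂ)).det = 0 := by
  have hZ : Ω ∈ siegelUpperHalfSpace (n₁ + n₂) :=
    blockDiag_mem_siegelUpperHalfSpace Ω₁ Ω₂ hΩ hΩ₁ hpos₁ hΩ₂ hpos₂
  set D : Matrix (Fin (n₁ + n₂)) (Fin (n₁ + n₂)) ℂ := denom (M.map ((↑) : ℤ → ℂ)) Ω with hD
  have hDu : IsUnit Dᵀ.det := by
    rw [Matrix.det_transpose]
    exact isUnit_det_denom_intCast hM hZ
  -- `w = ᵗD⁻¹ v` with `v = ᵗD w`
  set v : Fin (n₁ + n₂) → ℂ := Dᵀ *ᵥ w with hv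
  have hw' : Dᵀ⁻¹ *ᵥ v = w := by
    rw [hv, Matrix.mulVec_mulVec, Matrix.nonsing_inv_mul _ hDu, Matrix.one_mulVec]
  have h0 : riemannThetaChar 0 0 Ω v = 0 := by
    rw [← riemannThetaChar_moeb_mulVec_eq_zero_iff hM hZ 0 0 v, hw']
    exact hw
  have h0' : riemannTheta Ω v = 0 := by rwa [riemannThetaChar_zero_zero] at h0
  have key := det_borderedHessian_riemannTheta_blockDiag_eq_zero hΩ hpos₁ hpos₂ v h0'
  have hF : riemannThetaChar 0 0 Ω = riemannTheta Ω := funext (riemannThetaChar_zero_zero Ω)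
  rw [← hF] at key
  have h := (det_borderedHessian_riemannThetaChar_moeb_mulVec_eq_zero_iff hM hZ 0 0 h0).2 key
  rwa [hw'] at h

end BlockDiag

end ComplexTorus

end Literature.Geometry.Kaehler
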